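import Summits.CriticalPhenomena.PercolationContinuityZ3.Theorems.PercNearOneGluingNoHeavyQuantTwoBigChain
import HarnessLib

/-!
# QUANT lane R8, Conjecture DIB\* — the two-big certificate, part 3: conversion lemma

builds on p205010 (kernel theorem, internal audit signed; external expert review pending)

Support file (`--supports stmt-CriticalPhenomena-4575`), QUANT lane census-1 (gen 17); memo
`run/shared/lean/prim/quant/prim-quant-census-1/TWOBIG-G17.md`.  Theorems only, no definitions, no sorries, standard axioms.
From the cell inequality in the weights `Pᵢ = αᵢpᵢ`, `Qᵢ = αᵢ(1 − pᵢ)` to the certificate form (divide by `α₁α₂ > 0`).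
[this work]; the gluing rows served [cite: KozmaNitzan2024, Conjecture 3 (p. 15)].
-/

namespace Summit.CriticalPhenomena.PercolationContinuityZ3.Theorems

namespace Quant

namespace IndepBlob

/-- From the cell inequality in the weights `Pᵢ = αᵢpᵢ`, `Qᵢ = αᵢ(1 − pᵢ)` to the certificate's form (divide by `α₁α₂ > 0`). [this work] -/
theorem tbc_convert (y A₁ A₂ p₁ p₂ P₁ Q₁ P₂ Q₂ z₁ z₂ z₀ : ℝ) (hA₁ : 0 < A₁) (hA₂ : 0 < A₂) (hP₁ : A₁ * p₁ = P₁)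
    (hQ₁ : A₁ * (1 - p₁) = Q₁) (hP₂ : A₂ * p₂ = P₂) (hQ₂ : A₂ * (1 - p₂) = Q₂)
    (h : (1 - y) * (A₁ * A₂) ≤ P₁ * P₂ + P₁ * Q₂ * z₁ + Q₁ * P₂ * z₂ + Q₁ * Q₂ * z₀) :
    1 - y ≤ p₁ * p₂ + p₁ * (1 - p₂) * z₁ + (1 - p₁) * p₂ * z₂ + (1 - p₁) * (1 - p₂) * z₀ := by
  subst hP₁ hQ₁ hP₂ hQ₂
  have e : A₁ * p₁ * (A₂ * p₂) + A₁ * p₁ * (A₂ * (1 - p₂)) * z₁ + A₁ * (1 - p₁) * (A₂ * p₂) * z₂ + A₁ * (1 - p₁) * (A₂ * (1 - p₂)) * z₀ =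
      (A₁ * A₂) * (p₁ * p₂ + p₁ * (1 - p₂) * z₁ + (1 - p₁) * p₂ * z₂ + (1 - p₁) * (1 - p₂) * z₀) := by ring
  rw [e] at h
  have h' : (A₁ * A₂) * (1 - y) ≤ (A₁ * A₂) * (p₁ * p₂ + p₁ * (1 - p₂) * z₁ + (1 - p₁) * p₂ * z₂ + (1 - p₁) * (1 - p₂) * z₀) := by linarith
  exact le_of_mul_le_mul_left h' (mul_pos hA₁ hA₂)


end IndepBlob

end Quant

end Summit.CriticalPhenomena.PercolationContinuityZ3.Theorems
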